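import Mathlib
import Summits.Ventures.PercRepro2.Defs
import Summits.Ventures.PercRepro2.Graph
import Summits.Ventures.PercRepro2.OneColourSwitch
import Summits.Ventures.PercRepro2.RegionHubSign
import Summits.Ventures.PercRepro2.SideSwitch
import Summits.Ventures.PercRepro2.SideSwitchFibre
import Summits.Ventures.PercRepro2.SideSwitchComps
import Summits.Ventures.PercRepro2.M9NoPocketDefs
import Summits.Ventures.PercRepro2.M9NoPocketWorld
import Summits.Ventures.PercRepro2.M9NoPocketWorldD
import Summits.Ventures.PercRepro2.M9NoPocketCompl
import Summits.Ventures.PercRepro2.M9NoPocketCompl2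
import Summits.Ventures.PercRepro2.M9NoPocketFlipRS
import Summits.Ventures.PercRepro2.M9PsiOneDefs


/-!
# The colour flip of an assignment and the outside flip, at the level of connections (blind
cell PercRepro2, p3 g36, 2026-08-29; `proofs/P3-NPHDR.md` §5(a)–(b))

Connections are blind to loops (`conn_iff_of_eqOn_nonloop`), so without an `r`–`s` edge the
colour flip of an assignment is, for every connection, the assignment of the dual block set to
the outside-flipped representative (`conn_compl_assignX_iff`; `compl_assignX_eq_off_rs` of
`M9NoPocketCompl2` holds off the edges inside `{r, s}`, which are loops), hence the colour
preference of an assignment is minus that of the dual assignment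
(`sigma_assignX_eq_neg_dual`), and `r ~_Y s` in an assignment is blind to the outside flip of
the representative (`conn_rs_assignX_flipOp_iff`, from `M9NoPocketFlipRS`).  Own work; std
axioms.
-/

namespace Summit.Ventures.PercRepro2

namespace NoPocket

open Finset Classical RegionHub OneColourSwitch SideSwitch

variable {V : Type*} {E : Type*}

section Loops

variable {ends : E → Sym2 V}

/-- Two colourings agreeing on the non-loop edges have the same open graph. -/
lemma openGraph_eq_of_eqOn_nonloop {ω ω' : Config E}
    (h : ∀ e, (∀ u, ends e ≠ s(u, u)) → ω e = ω' e) : openGraph ends ω = openGraph ends ω' := by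
  ext u v
  rw [openGraph_adj, openGraph_adj]
  have key : ∀ {e : E}, ends e = s(u, v) → u ≠ v → ω e = ω' e := by
    intro e hends huv
    refine h e (fun w hw => ?_)
    rw [hends, Sym2.eq_iff] at hw
    rcases hw with ⟨rfl, rfl⟩ | ⟨rfl, rfl⟩ <;> exact huv rfl
  constructor
  · rintro ⟨huv, e, he, hends⟩
    exact ⟨huv, e, by rw [← key hends huv]; exact he, hends⟩
  · rintro ⟨huv, e, he, hends⟩
    exact ⟨huv, e, by rw [key hends huv]; exact he, hends⟩

/-- Connections are blind to the colours of the loops. -/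
lemma conn_iff_of_eqOn_nonloop {ω ω' : Config E}
    (h : ∀ e, (∀ u, ends e ≠ s(u, u)) → ω e = ω' e) (a b : V) :
    Conn ends ω a b ↔ Conn ends ω' a b := by
  unfold Conn
  rw [openGraph_eq_of_eqOn_nonloop h]

/-- An edge inside `{r, s}` that is not a loop is an `r`–`s` edge. -/
lemma eq_rs_of_within_pair {r s : V} {e : E} (hw : e ∈ within ends ({r, s} : Set V))
    (hne : ∀ u, ends e ≠ s(u, u)) : ends e = s(r, s) := by
  obtain ⟨x, hx, y, hy, hends⟩ := hw
  simp only [Set.mem_insert_iff, Set.mem_singleton_iff] at hx hy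
  rcases hx with hx | hx <;> rcases hy with hy | hy <;> rw [hx, hy] at hends
  · exact absurd hends (hne r)
  · exact hends
  · rw [hends, Sym2.eq_swap]
  · exact absurd hends (hne s)

end Loops

section Links

variable [Fintype V] [DecidableEq V] [Fintype E] [DecidableEq E] {ends : E → Sym2 V}

/-- The dual of a block set (no `T`-edges). -/
lemma cdual_pair_eq {d r s : V} (hT : Tset ends d r s = ∅) (ρ : Config E)
    (X : Finset (Finset V)) :
    cdual ends d r s ρ (X, ∅) = (blocks ends d r s ρ \ X, ∅) := by
  simp only [cdual, hT, Finset.sdiff_empty]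

/-- **The colour flip of an assignment is the dual assignment, for every connection**, when
there is no `r`–`s` edge. -/
theorem conn_compl_assignX_iff {p q r s d : V} (hnp : NoPocketAt ends d r s) (hr : d ≠ r)
    (hs : d ≠ s) (hT : Tset ends d r s = ∅) (hrs : ∀ e, ends e ≠ s(r, s)) {ρ : Config E}
    (hρ : ρ ∈ RepD ends p q r s d) {X : Finset (Finset V)} (hX : X ⊆ blocks ends d r s ρ)
    (a b : V) :
    Conn ends (OneColourSwitch.compl (assignX ends (X, ∅) ρ)) a b ↔
      Conn ends (assignX ends (blocks ends d r s ρ \ X, ∅) (flipOp ends d r s ρ)) a b := by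
  refine conn_iff_of_eqOn_nonloop (fun e hne => ?_) a b
  have hw : e ∉ within ends ({r, s} : Set V) := fun hw => hrs e (eq_rs_of_within_pair hw hne)
  have h := compl_assignX_eq_off_rs hnp hr hs hρ (x := (X, ∅)) hX (Finset.empty_subset _) hw
  rw [h, cdual_pair_eq hT]

/-- The colour preference of an assignment is minus that of the dual assignment. -/
theorem sigma_assignX_eq_neg_dual {p q r s d : V} (hnp : NoPocketAt ends d r s) (hr : d ≠ r)
    (hs : d ≠ s) (hT : Tset ends d r s = ∅) (hrs : ∀ e, ends e ≠ s(r, s)) {ρ : Config E}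
    (hρ : ρ ∈ RepD ends p q r s d) {X : Finset (Finset V)} (hX : X ⊆ blocks ends d r s ρ)
    (a b : V) :
    sigma ends (assignX ends (X, ∅) ρ) a b =
      - sigma ends (assignX ends (blocks ends d r s ρ \ X, ∅) (flipOp ends d r s ρ)) a b := by
  have h1 := conn_compl_assignX_iff hnp hr hs hT hrs hρ hX a b
  have hρO := flipOp_mem_RepD hr hs hρ
  have hX' : blocks ends d r s ρ \ X ⊆ blocks ends d r s (flipOp ends d r s ρ) := by
    rw [blocks_flipOp hr hs]
    exact Finset.sdiff_subset
  have h2 := conn_compl_assignX_iff hnp hr hs hT hrs hρO hX' a b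
  rw [blocks_flipOp hr hs, Finset.sdiff_sdiff_eq_self hX, flipOp_flipOp hr hs] at h2
  simp only [sigma, h1, h2]
  ring

/-- `r ~_Y s` in an assignment is blind to the outside flip of the representative. -/
theorem conn_rs_assignX_flipOp_iff {p q r s d : V} (hnp : NoPocketAt ends d r s) (hr : d ≠ r)
    (hs : d ≠ s) {ρ : Config E} (hρ : ρ ∈ RepD ends p q r s d)
    {x : Finset (Finset V) × Finset E} (hx : x ∈ L4 ends d r s ρ) :
    Conn ends (assignX ends x (flipOp ends d r s ρ)) r s ↔ Conn ends (assignX ends x ρ) r s := by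
  rw [assignX_flipOp]
  constructor
  · intro h
    have hρO := flipOp_mem_RepD hr hs hρ
    have hxO : x ∈ L4 ends d r s (flipOp ends d r s ρ) := by rw [L4_flipOp hr hs]; exact hx
    have h' := conn_rs_flipIn_Oprime_of_conn hnp hr hs hρO hxO (by rw [assignX_flipOp]; exact h)
    rw [assignX_flipOp, Oprime_flipOp hr hs, flipIn_flipIn] at h'
    exact h'
  · exact conn_rs_flipIn_Oprime_of_conn hnp hr hs hρ hx

end Links

end NoPocket

end Summit.Ventures.PercRepro2
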